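/-
Copyright (c) 2026 the pub-hodgecm-mathlib formalisation cell (harness21).  Prover seat hodgecm-mathlib-F0P3a-p03 (g17): «S3-ram» seeding wave (LEAD F0P3a-plan (g12)
T11-41∕T11-76; owner F0P3a-p06 (g15)), row «(α₂) (f)-ram TWO-CLASSES ASSEMBLY (place-generic)», FILE 1∕2 (match existence from a similitude frame); 2026-09-01.
-/
import Literature.NumberTheory.Rogawski1990.UnitFundamentalLemmaInertIrredClauseOfValuesStubFrame  -- ★ `exists_isLocalNormPair_of_nonsplit` (the inert original); brings `localNonsplitCongr`, `endoEmbLocal`, `IsLocalNormPair`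
import HarnessLib

/-!
# Every `γ_H ∈ H_v` has a match in `U(H′)(L⁺_v)` at a NON-SPLIT place, given a similitude `ᵗ(σ_w T)·Φ₃·T = c·H′_w` — in particular given the wave's integral
# antidiagonal frame `H′_w = (−det H′_w)·ᵗ(σ_w A)·Φ₃·A` (Rogawski 1990 §14.2; Jacobowitz 1962 Thm. 7.1)

Topic `NumberTheory/Rogawski1990`; namespace `Literature.NumberTheory.Rogawski1990`.  THEOREMS ONLY (no definition, no named fact, no instance, no notation, no `sorry`).
Cell `pub/hodgecm-mathlib`, crux H413 (`--supports stmt-HodgeConjecture-24833`), «S3-ram» seeding wave (Literature seeding, count-neutral): the PLACE-GENERIC (ramified-ready)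
form of ★ `exists_isLocalNormPair_of_nonsplit` (B-p14 ∕ F0P3-p02 lineage), which draws its frame `T` from the UNRAMIFIED integral hyperbolic basis (`hv`, `hH′w`, `hH′i`).
Here the frame is a HYPOTHESIS: any `T ∈ GL₃(L_w)` and unit `c` with `formCongr σ_w T Φ₃ = c • H′_w`; the transport `ψ = localNonsplitCongr … T : U(H′)(L⁺_v) ≃ U(Φ₃)(L⁺_v)`
(`(ψ g)_w = T·g_w·T⁻¹`, ★ `localNonsplitEquiv_localNonsplitCongr`) sends `γ₀ := ψ⁻¹(ι_v γ_H)` to `ι_v γ_H` up to `GL₃`-conjugacy, i.e. `ι_v(γ_H) ↔ γ₀` (★ `IsLocalNormPair` =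
`Corresponds` = `GL₃(L_v)`-conjugacy of the embedded element).  At a tame-ramified `w` the wave's frame token `hframe : placeForm H′ w = (−det) • formCongr σ_w A (Φ₃)` (★ p846344
`exists_glInt_placeForm_eq_smul_formCongr_antidiagonal_of_neg`) is such a similitude with `c = (−det H′_w)⁻¹` (§2).  Consumer: FILE 2∕2 `UnitFundamentalLemmaNonsplitTwoClassesAssembly`
(the type-(2) two-classes assembly fed by the frame) and every ramified clause that needs ONE match of `γ_H` (fold v7 §1a (T1)(T2)).
HONEST LABEL: HC_CM is proved only modulo the 2 remaining named inputs (hLiu418 24832, h413 24833) until rung 0 closes; this file is elementary transport, no books consequence.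

## References
* [Rogawski1990] J. D. Rogawski, *Automorphic Representations of Unitary Groups in Three Variables*, Ann. of Math. Stud. 123 (1990), §14.2 p. 233, §4.3 p. 43.
* [Jacobowitz1962] R. Jacobowitz, *Hermitian forms over local fields*, Amer. J. Math. 84 (1962), §7 Thm. 7.1.
* [PlatonovRapinchuk1994] V. Platonov, A. Rapinchuk, *Algebraic Groups and Number Theory* (1994), §2.3 (transport of structure along a similitude).
-/

set_option autoImplicit false

noncomputable section

open NumberField IsDedekindDomain Matrix
open scoped MatrixGroups

namespace Literature.NumberTheory.Rogawski1990

open Literature.NumberTheory.Automorphic Literature.NumberTheory.Automorphic.UnitaryGroup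
open Literature.NumberTheory.GaloisRepresentations Literature.NumberTheory.NumberFields Literature.NumberTheory.QuadraticForms
open Literature.AlgebraicGeometry.ShimuraVarieties (unitaryGroup mem_unitaryGroup_iff)

/-! ## §1 A match from a similitude `ᵗ(σ_w T)·Φ₃·T = c·H′_w`; §2 from the frame token -/

section Frame

variable (L : Type) [Field L] [NumberField L] [IsCMField L] (H' : Matrix (Fin 3) (Fin 3) L)
  {v : HeightOneSpectrum (𝓞 ↥(maximalRealSubfield L))}

/-- `IsConj` descends along a multiplicative equivalence. [folklore] -/
private theorem isConj_of_isConj_mulEquiv₂ {G G' : Type*} [Monoid G] [Monoid G'] (e : G ≃* G') {a b : G}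
    (h : IsConj (e a) (e b)) : IsConj a b := by
  have h' := MonoidHom.map_isConj e.symm.toMonoidHom h
  simpa using h'

/-- **EVERY `γ_H ∈ H_v` HAS A MATCH IN `G′_v = U(H′)(L⁺_v)` AT A NON-SPLIT PLACE, GIVEN A SIMILITUDE `ᵗ(σ_w T)·Φ₃·T = c·H′_w`** (`c` a unit): `γ₀ := ψ⁻¹(ι_v γ_H)` for the transport
`ψ = localNonsplitCongr … T : U(H′)(L⁺_v) ≃ U(Φ₃)(L⁺_v)` (`(ψ g)_w = T g_w T⁻¹`) — the place-generic form of ★ `exists_isLocalNormPair_of_nonsplit` (there `T` is the unramified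
hyperbolic basis, `c = 1`). [cite: Rogawski1990, §14.2 p. 233; §4.3 p. 43] [cite: Jacobowitz1962, §7 Thm. 7.1] -/
theorem exists_isLocalNormPair_of_formCongr (w : PlacesOver L v) (hw : IsCMField.complexConj L • w.1 = w.1)
    (T : GL (Fin 3) (w.1.adicCompletion L)) {c : w.1.adicCompletion L} (hc : IsUnit c)
    (hT : formCongr (galAdicCompletionMap (L := L) (IsCMField.complexConj L) hw) T ((StdForm.antidiagonal 3).over (w.1.adicCompletion L)) = c • placeForm H' w.1)
    (γH : (cmDatum L 2 (Matrix.of fun i j : Fin 2 => if i.val + j.val + 1 = 2 then (1 : L) else 0)).Local v ×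
      (cmDatum L 1 (Matrix.of fun i j : Fin 1 => if i.val + j.val + 1 = 1 then (1 : L) else 0)).Local v) :
    ∃ γ₀ : (cmDatum L 3 H').Local v, IsLocalNormPair L H' v γH γ₀ := by
  have hcne := IsCMField.complexConj_ne_one L
  haveI : Algebra.IsQuadraticExtension ↥(maximalRealSubfield L) L := IsCMField.isQuadraticExtension L
  have h : formCongr (galAdicCompletionMap (L := L) (IsCMField.complexConj L) hw) T
      (placeForm (Matrix.of fun i j : Fin 3 => if i.val + j.val + 1 = 3 then (1 : L) else 0) w.1) = c • placeForm H' w.1 := by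
    rw [placeForm_antidiagOne, hT]
  set ψ := localNonsplitCongr (IsCMField.complexConj L) hcne w hw T hc h with hψ
  set x := endoEmbLocal L v γH with hx
  have hψx : ((localNonsplitEquiv (IsCMField.complexConj L)
        (Matrix.of fun i j : Fin 3 => if i.val + j.val + 1 = 3 then (1 : L) else 0) hcne w hw (ψ (ψ.symm x)) :
        unitaryGroupOfForm (galAdicCompletionMap (L := L) (IsCMField.complexConj L) hw)
          (placeForm (Matrix.of fun i j : Fin 3 => if i.val + j.val + 1 = 3 then (1 : L) else 0) w.1)) :
        GL (Fin 3) (w.1.adicCompletion L)) =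
      T * ((localNonsplitEquiv (IsCMField.complexConj L) H' hcne w hw (ψ.symm x) :
        unitaryGroupOfForm (galAdicCompletionMap (L := L) (IsCMField.complexConj L) hw) (placeForm H' w.1)) :
        GL (Fin 3) (w.1.adicCompletion L)) * T⁻¹ :=
    localNonsplitEquiv_localNonsplitCongr (IsCMField.complexConj L) hcne w hw T hc h (ψ.symm x)
  rw [ContinuousMulEquiv.apply_symm_apply] at hψx
  have hconj : ((localNonsplitEquiv (IsCMField.complexConj L) H' hcne w hw (ψ.symm x) :
        unitaryGroupOfForm (galAdicCompletionMap (L := L) (IsCMField.complexConj L) hw) (placeForm H' w.1)) :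
        GL (Fin 3) (w.1.adicCompletion L)) =
      T⁻¹ * ((localNonsplitEquiv (IsCMField.complexConj L)
        (Matrix.of fun i j : Fin 3 => if i.val + j.val + 1 = 3 then (1 : L) else 0) hcne w hw x :
        unitaryGroupOfForm (galAdicCompletionMap (L := L) (IsCMField.complexConj L) hw)
          (placeForm (Matrix.of fun i j : Fin 3 => if i.val + j.val + 1 = 3 then (1 : L) else 0) w.1)) :
        GL (Fin 3) (w.1.adicCompletion L)) * T := by
    rw [hψx]; group
  refine ⟨ψ.symm x, ?_⟩
  show IsConj ((x.val : GL (Fin 3) (LocalRing L v))) ((ψ.symm x).val : GL (Fin 3) (LocalRing L v))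
  refine isConj_of_isConj_mulEquiv₂
    ((localGLPiEquiv L 3 v).toMulEquiv.trans (localGLPiEvalEquiv (IsCMField.complexConj L) 3 hcne w hw).toMulEquiv) ?_
  show IsConj
    ((localNonsplitEquiv (IsCMField.complexConj L)
      (Matrix.of fun i j : Fin 3 => if i.val + j.val + 1 = 3 then (1 : L) else 0) hcne w hw x :
      unitaryGroupOfForm (galAdicCompletionMap (L := L) (IsCMField.complexConj L) hw)
        (placeForm (Matrix.of fun i j : Fin 3 => if i.val + j.val + 1 = 3 then (1 : L) else 0) w.1)) :
      GL (Fin 3) (w.1.adicCompletion L))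
    ((localNonsplitEquiv (IsCMField.complexConj L) H' hcne w hw (ψ.symm x) :
      unitaryGroupOfForm (galAdicCompletionMap (L := L) (IsCMField.complexConj L) hw) (placeForm H' w.1)) :
      GL (Fin 3) (w.1.adicCompletion L))
  rw [hconj]
  exact isConj_iff.2 ⟨T⁻¹, by group⟩

/-- **EXISTENCE OF A MATCH FROM THE WAVE'S INTEGRAL ANTIDIAGONAL FRAME TOKEN** `hframe : H′_w = (−det H′_w) • ᵗ(σ_w A)·Φ₃·A` (★ p846344 at a tame-ramified `w`, ★ the
unramified hyperbolic basis at an inert `w`): every `γ_H ∈ H_v` has a match in `U(H′)(L⁺_v)`. [cite: Rogawski1990, §14.2 p. 233; §4.3 p. 43] [cite: Jacobowitz1962, §7 Thm. 7.1] -/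
theorem exists_isLocalNormPair_of_frame (w : PlacesOver L v) (hw : IsCMField.complexConj L • w.1 = w.1)
    (hH'w : IsUnit (placeForm H' w.1)) (A : GL (Fin 3) (w.1.adicCompletion L))
    (hframe : placeForm H' w.1 = (-(placeForm H' w.1).det) •
      formCongr (galAdicCompletionMap (L := L) (IsCMField.complexConj L) hw) A ((StdForm.antidiagonal 3).over (w.1.adicCompletion L)))
    (γH : (cmDatum L 2 (Matrix.of fun i j : Fin 2 => if i.val + j.val + 1 = 2 then (1 : L) else 0)).Local v ×
      (cmDatum L 1 (Matrix.of fun i j : Fin 1 => if i.val + j.val + 1 = 1 then (1 : L) else 0)).Local v) :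
    ∃ γ₀ : (cmDatum L 3 H').Local v, IsLocalNormPair L H' v γH γ₀ := by
  have hd : IsUnit (-(placeForm H' w.1).det) := ((Matrix.isUnit_iff_isUnit_det _).1 hH'w).neg
  have hd0 : (-(placeForm H' w.1).det) ≠ 0 := hd.ne_zero
  refine exists_isLocalNormPair_of_formCongr L H' w hw A (c := (-(placeForm H' w.1).det)⁻¹) hd.inv ?_ γH
  rw [← inv_smul_smul₀ hd0 (formCongr (galAdicCompletionMap (L := L) (IsCMField.complexConj L) hw) A
    ((StdForm.antidiagonal 3).over (w.1.adicCompletion L))), ← hframe]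

end Frame

end Literature.NumberTheory.Rogawski1990

end
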